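import Summits.Ventures.PercRepro.S1ChainSkewCount

/-!
# PercRepro — THE ONE-POINT FOUR-CIRCUIT CAP IN A SKEW UNION (p2, gen 24; SUBCLAIM-S1 §6.9 (vii) step 4, part 2)

For a point `z ∉ U` in the closure of a skew union `U = ⋃𝒯` of triangles with principal closed trace `F`: the trace
`C ∩ F` of a four-circuit `C ∋ z`, `C ⊆ U ∪ {z}`, determines `C` (S1ChainSkewCount), it has three points or one, at
most one triangle lies inside `F`, and `|F| ≤ 4` (`≤ 3` when a one-point trace occurs). Hence the four-circuits
through `z` inside `U ∪ {z}` inject into the three-subsets of `F` (`C(|F|, 3) ≤ 4` of them), or into the three- and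
one-subsets of a set of `≤ 3` points (`≤ 1 + 3`): **at most four** — the sharp value is three (§6.9 (vii); the
three-subsets of a four-point `F` all contain the point of `F` off its triangle), not needed by the cell lines.

* `ncard_inter_principal_le` — `|F ∩ T| ≤ |B ∩ T| + [T ⊆ F]`;
* `card_filter_subset_principal_le_one` — at most one triangle inside `F`;
* `ncard_principal_le` — `|F| ≤ 4`, and `≤ 3` without a triangle inside `F`;
* **`ncard_fourCircuits_through_le_four`** — the cap.
Axioms: standard.
-/

open scoped Matroid

namespace PercRepro

namespace S1

open Set

variable {α : Type}

open scoped Classical in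
/-- The trace of `F` on a triangle is at most the trace of `B`, plus one on a triangle inside `F`. -/
theorem ncard_inter_principal_le (M : Matroid α) [M.Finite] (𝒯 : Finset (Set α))
    (h𝒯 : ∀ C ∈ 𝒯, M.IsCircuit C ∧ C.ncard = 3) (hskew : M.eRk (⋃ C ∈ 𝒯, C) = 2 * 𝒯.card)
    {z : α} (hzU : z ∉ ⋃ C ∈ 𝒯, C) {F : Set α} (hFU : F ⊆ ⋃ C ∈ 𝒯, C)
    (hFcl : ∀ T ∈ 𝒯, (F ∩ T).ncard ≤ 1 ∨ T ⊆ F) (hzF : z ∈ M.closure F)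
    (hFmin : ∀ A ⊆ ⋃ C ∈ 𝒯, C, (∀ T ∈ 𝒯, (A ∩ T).ncard ≤ 1 ∨ T ⊆ A) → z ∈ M.closure A → F ⊆ A)
    {B : Set α} (hB : B ⊆ ⋃ C ∈ 𝒯, C) (hC : M.IsCircuit (insert z B)) {T : Set α} (hT : T ∈ 𝒯) :
    (F ∩ T).ncard ≤ (B ∩ T).ncard + (if T ⊆ F then 1 else 0) ∧ (¬ T ⊆ F → (F ∩ T).ncard ≤ (B ∩ T).ncard) := by
  rcases trace_cases M 𝒯 h𝒯 hskew hzU hFU hFcl hzF hFmin hB hC hT with ⟨hBT, hFT⟩ | ⟨hTF, h2⟩ | ⟨a, hFa, hBa⟩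
  · rw [hBT, hFT, Set.ncard_empty]
    exact ⟨Nat.zero_le _, fun _ => le_rfl⟩
  · refine ⟨?_, fun h => absurd hTF h⟩
    rw [if_pos hTF, h2, Set.inter_eq_right.2 hTF, (h𝒯 T hT).2]
  · have h1 : (F ∩ T).ncard = 1 := by rw [hFa, Set.ncard_singleton]
    have hB1 : 1 ≤ (B ∩ T).ncard := by
      rcases hBa with hBa | ⟨h2, -⟩
      · rw [hBa, Set.ncard_singleton]
      · omega
    refine ⟨by rw [h1]; split_ifs <;> omega, fun _ => by rw [h1]; exact hB1⟩

open scoped Classical in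
/-- At most one triangle lies inside `F` (two would carry four points of `B`). -/
theorem card_filter_subset_principal_le_one (M : Matroid α) [M.Finite] (𝒯 : Finset (Set α))
    (h𝒯 : ∀ C ∈ 𝒯, M.IsCircuit C ∧ C.ncard = 3) (hskew : M.eRk (⋃ C ∈ 𝒯, C) = 2 * 𝒯.card)
    {z : α} (hzU : z ∉ ⋃ C ∈ 𝒯, C) {F : Set α} (hFU : F ⊆ ⋃ C ∈ 𝒯, C) (hzF : z ∈ M.closure F)
    (hFmin : ∀ A ⊆ ⋃ C ∈ 𝒯, C, (∀ T ∈ 𝒯, (A ∩ T).ncard ≤ 1 ∨ T ⊆ A) → z ∈ M.closure A → F ⊆ A)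
    {B : Set α} (hB : B ⊆ ⋃ C ∈ 𝒯, C) (hC : M.IsCircuit (insert z B)) (hB3 : B.ncard = 3) :
    (𝒯.filter (fun T => T ⊆ F)).card ≤ 1 := by
  classical
  by_contra hlt
  push Not at hlt
  obtain ⟨T, hT, T', hT', hne⟩ := Finset.one_lt_card.1 hlt
  rw [Finset.mem_filter] at hT hT'
  have hUfin : (⋃ C ∈ 𝒯, C).Finite := M.ground_finite.subset (biUnion_subset_ground M 𝒯 h𝒯)
  have hBfin : B.Finite := hUfin.subset hB
  have h2 := ncard_inter_eq_two_of_subset_principal M 𝒯 h𝒯 hskew hzU hFU hzF hFmin hB hC hT.1 hT.2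
  have h2' := ncard_inter_eq_two_of_subset_principal M 𝒯 h𝒯 hskew hzU hFU hzF hFmin hB hC hT'.1 hT'.2
  have hd : Disjoint (B ∩ T) (B ∩ T') := by
    rw [Set.disjoint_left]
    rintro w ⟨-, hw1⟩ ⟨-, hw2⟩
    exact Set.disjoint_left.1 (disjoint_of_skew_union M 𝒯 h𝒯 hskew hT.1 hT'.1 hne) hw1 hw2
  have := Set.ncard_le_ncard (Set.union_subset Set.inter_subset_left Set.inter_subset_left :
    (B ∩ T) ∪ (B ∩ T') ⊆ B) hBfin
  rw [Set.ncard_union_eq hd (hBfin.subset Set.inter_subset_left) (hBfin.subset Set.inter_subset_left), h2, h2',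
    hB3] at this
  omega

open scoped Classical in
/-- **`|F| ≤ 4`**, and `|F| ≤ 3` when no triangle lies inside `F`, whenever some circuit through `z` has three
points in `U`. -/
theorem ncard_principal_le (M : Matroid α) [M.Finite] (𝒯 : Finset (Set α))
    (h𝒯 : ∀ C ∈ 𝒯, M.IsCircuit C ∧ C.ncard = 3) (hskew : M.eRk (⋃ C ∈ 𝒯, C) = 2 * 𝒯.card)
    {z : α} (hzU : z ∉ ⋃ C ∈ 𝒯, C) {F : Set α} (hFU : F ⊆ ⋃ C ∈ 𝒯, C)
    (hFcl : ∀ T ∈ 𝒯, (F ∩ T).ncard ≤ 1 ∨ T ⊆ F) (hzF : z ∈ M.closure F)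
    (hFmin : ∀ A ⊆ ⋃ C ∈ 𝒯, C, (∀ T ∈ 𝒯, (A ∩ T).ncard ≤ 1 ∨ T ⊆ A) → z ∈ M.closure A → F ⊆ A)
    {B : Set α} (hB : B ⊆ ⋃ C ∈ 𝒯, C) (hC : M.IsCircuit (insert z B)) (hB3 : B.ncard = 3) :
    F.ncard ≤ 4 ∧ ((∀ T ∈ 𝒯, ¬ T ⊆ F) → F.ncard ≤ 3) := by
  classical
  have hFsum := ncard_eq_sum_inter_of_skew_union M 𝒯 h𝒯 hskew hFU
  have hBsum := ncard_eq_sum_inter_of_skew_union M 𝒯 h𝒯 hskew hB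
  have hL := card_filter_subset_principal_le_one M 𝒯 h𝒯 hskew hzU hFU hzF hFmin hB hC hB3
  constructor
  · calc F.ncard = ∑ T ∈ 𝒯, (F ∩ T).ncard := hFsum
      _ ≤ ∑ T ∈ 𝒯, ((B ∩ T).ncard + (if T ⊆ F then 1 else 0)) := by
          apply Finset.sum_le_sum
          intro T hT
          exact (ncard_inter_principal_le M 𝒯 h𝒯 hskew hzU hFU hFcl hzF hFmin hB hC hT).1
      _ = B.ncard + (𝒯.filter (fun T => T ⊆ F)).card := by
          rw [Finset.sum_add_distrib, ← hBsum, Finset.sum_boole]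
          simp
      _ ≤ 4 := by omega
  · intro hnoL
    calc F.ncard = ∑ T ∈ 𝒯, (F ∩ T).ncard := hFsum
      _ ≤ ∑ T ∈ 𝒯, (B ∩ T).ncard := by
          apply Finset.sum_le_sum
          intro T hT
          exact (ncard_inter_principal_le M 𝒯 h𝒯 hskew hzU hFU hFcl hzF hFmin hB hC hT).2 (hnoL T hT)
      _ = 3 := by rw [← hBsum, hB3]

/-- **THE ONE-POINT FOUR-CIRCUIT CAP**: at most FOUR four-circuits through an outside point `z` lie inside
`U ∪ {z}` (the trace on the principal closed trace `F` determines the circuit, has three points or one, and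
`|F| ≤ 4` — `≤ 3` when a one-point trace occurs). -/
theorem ncard_fourCircuits_through_le_four (M : Matroid α) [M.Finite] (𝒯 : Finset (Set α))
    (h𝒯 : ∀ C ∈ 𝒯, M.IsCircuit C ∧ C.ncard = 3) (hskew : M.eRk (⋃ C ∈ 𝒯, C) = 2 * 𝒯.card)
    {z : α} (hzE : z ∈ M.E) (hzU : z ∉ ⋃ C ∈ 𝒯, C) (hzcl : z ∈ M.closure (⋃ C ∈ 𝒯, C)) :
    {C : Set α | M.IsCircuit C ∧ C.ncard = 4 ∧ z ∈ C ∧ C ⊆ insert z (⋃ C' ∈ 𝒯, C')}.ncard ≤ 4 := by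
  classical
  obtain ⟨F, hFU, hFcl, hzF, hFmin⟩ := exists_principal_closedTrace M 𝒯 h𝒯 hskew hzE hzcl
  have hUfin : (⋃ C ∈ 𝒯, C).Finite := M.ground_finite.subset (biUnion_subset_ground M 𝒯 h𝒯)
  have hFfin : F.Finite := hUfin.subset hFU
  have hzF' : z ∉ F := fun h => hzU (hFU h)
  set 𝒞 := {C : Set α | M.IsCircuit C ∧ C.ncard = 4 ∧ z ∈ C ∧ C ⊆ insert z (⋃ C' ∈ 𝒯, C')} with h𝒞
  -- the trace `B = C ∖ {z}` of a member
  have hmem : ∀ C ∈ 𝒞, (C \ {z}) ⊆ ⋃ C' ∈ 𝒯, C' ∧ (C \ {z}).ncard = 3 ∧ M.IsCircuit (insert z (C \ {z})) ∧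
      C ∩ F = (C \ {z}) ∩ F := by
    intro C hC
    obtain ⟨hcirc, h4, hzC, hsub⟩ := hC
    have hCfin : C.Finite := M.ground_finite.subset hcirc.subset_ground
    refine ⟨?_, ?_, ?_, ?_⟩
    · rintro x ⟨hxC, hxz⟩
      rcases hsub hxC with h | h
      · exact absurd h hxz
      · exact h
    · rw [Set.ncard_sdiff_singleton_of_mem hzC, h4]
    · rwa [Set.insert_sdiff_singleton, Set.insert_eq_of_mem hzC]
    · ext x; simp only [Set.mem_inter_iff, Set.mem_sdiff, Set.mem_singleton_iff]
      constructor
      · rintro ⟨hxC, hxF⟩; exact ⟨⟨hxC, fun h => hzF' (h ▸ hxF)⟩, hxF⟩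
      · rintro ⟨⟨hxC, -⟩, hxF⟩; exact ⟨hxC, hxF⟩
  -- `C ↦ C ∩ F` is injective on `𝒞`
  have hinj : Set.InjOn (fun C => C ∩ F) 𝒞 := by
    intro C hC C' hC' heq
    obtain ⟨hB, -, hcirc, hCF⟩ := hmem C hC
    obtain ⟨hB', -, hcirc', hCF'⟩ := hmem C' hC'
    simp only at heq
    rw [hCF, hCF'] at heq
    have := eq_of_inter_principal_eq M 𝒯 h𝒯 hskew hzU hFU hFcl hzF hFmin hB hcirc hB' hcirc' heq
    have hzC : z ∈ C := hC.2.2.1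
    have hzC' : z ∈ C' := hC'.2.2.1
    calc C = insert z (C \ {z}) := by rw [Set.insert_sdiff_singleton, Set.insert_eq_of_mem hzC]
      _ = insert z (C' \ {z}) := by rw [this]
      _ = C' := by rw [Set.insert_sdiff_singleton, Set.insert_eq_of_mem hzC']
  -- the image: traces of size `3` or `1`
  have himg : ∀ C ∈ 𝒞, (C ∩ F).ncard = 3 ∨ ((C ∩ F).ncard = 1 ∧ ∀ T ∈ 𝒯, ¬ T ⊆ F) := by
    intro C hC
    obtain ⟨hB, hB3, hcirc, hCF⟩ := hmem C hC
    rw [hCF]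
    exact ncard_inter_principal_cases M 𝒯 h𝒯 hskew hzU hFU hFcl hzF hFmin hB hcirc hB3
  have hsub3 : ∀ C ∈ 𝒞, C ∩ F ⊆ F := fun C _ => Set.inter_subset_right
  set 𝒳₃ := {X : Set α | X ⊆ F ∧ X.ncard = 3} with h𝒳₃
  set 𝒳₁ := {X : Set α | X ⊆ F ∧ X.ncard = 1} with h𝒳₁
  have h𝒳₃fin : 𝒳₃.Finite := hFfin.finite_subsets.subset (fun X hX => hX.1)
  have h𝒳₁fin : 𝒳₁.Finite := hFfin.finite_subsets.subset (fun X hX => hX.1)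
  have hc3 : 𝒳₃.ncard = F.ncard.choose 3 := ncard_subsets_eq_choose F hFfin 3
  have hc1 : 𝒳₁.ncard = F.ncard.choose 1 := ncard_subsets_eq_choose F hFfin 1
  by_cases hA : ∃ C ∈ 𝒞, (C ∩ F).ncard = 1
  · -- some trace has one point: no triangle inside `F`, `|F| ≤ 3`
    obtain ⟨C₀, hC₀, h1⟩ := hA
    obtain ⟨hB₀, hB₀3, hcirc₀, -⟩ := hmem C₀ hC₀
    have hnoL : ∀ T ∈ 𝒯, ¬ T ⊆ F := by
      rcases himg C₀ hC₀ with h3 | ⟨-, h⟩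
      · omega
      · exact h
    have hF3 : F.ncard ≤ 3 :=
      (ncard_principal_le M 𝒯 h𝒯 hskew hzU hFU hFcl hzF hFmin hB₀ hcirc₀ hB₀3).2 hnoL
    have hle : 𝒞.ncard ≤ (𝒳₃ ∪ 𝒳₁).ncard := by
      refine Set.ncard_le_ncard_of_injOn (fun C => C ∩ F) (fun C hC => ?_) hinj (h𝒳₃fin.union h𝒳₁fin)
      rcases himg C hC with h3 | ⟨h1', -⟩
      · exact Or.inl ⟨hsub3 C hC, h3⟩
      · exact Or.inr ⟨hsub3 C hC, h1'⟩
    have hunion := Set.ncard_union_le 𝒳₃ 𝒳₁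
    rw [hc3, hc1, Nat.choose_one_right] at hunion
    have hch : F.ncard.choose 3 ≤ 1 := by
      interval_cases F.ncard <;> decide
    omega
  · -- every trace has three points: `|F| ≤ 4`
    push Not at hA
    have hle : 𝒞.ncard ≤ 𝒳₃.ncard := by
      refine Set.ncard_le_ncard_of_injOn (fun C => C ∩ F) (fun C hC => ?_) hinj h𝒳₃fin
      rcases himg C hC with h3 | ⟨h1', -⟩
      · exact ⟨hsub3 C hC, h3⟩
      · exact absurd h1' (hA C hC)
    rcases Set.eq_empty_or_nonempty 𝒞 with hempty | ⟨C₀, hC₀⟩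
    · rw [hempty, Set.ncard_empty]; omega
    · obtain ⟨hB₀, hB₀3, hcirc₀, -⟩ := hmem C₀ hC₀
      have hF4 : F.ncard ≤ 4 :=
        (ncard_principal_le M 𝒯 h𝒯 hskew hzU hFU hFcl hzF hFmin hB₀ hcirc₀ hB₀3).1
      have hch : F.ncard.choose 3 ≤ 4 := by
        interval_cases F.ncard <;> decide
      omega

end S1

end PercRepro
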